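import Literature.Geometry.Riemannian.MetricFlowFDistanceRestrict
import Literature.Geometry.Riemannian.MetricFlowFConvergenceMeasures
import HarnessLib

/-!
# The `𝔽`-distance within a correspondence for metric flows carrying arbitrary conjugate heat
# flows (Bamler 2023, §5.1 Def. 5.6, as used in §6.4–6.5)

R. Bamler, *Compactness theory of the space of super Ricci flows*, Invent. Math. 233 (2023),
§5.1, Def. 5.6 (`𝔽`-distance within a correspondence) is formulated for metric flow PAIRS, but in
§6.4–6.5 (Lemma 6.10 / arXiv Lemma 139, Lemma 6.12 / arXiv 141, Thm. 6.13 / arXiv 143, change of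
basepoint) it is applied verbatim to flows carrying arbitrary conjugate heat flows `(𝒳ⁱ, (μ̃ⁱ_t))`,
e.g. conjugate heat kernels `ν_{x;·}`, which need not have full support and so are not
`MetricFlowPair`s of the tree (`IsOpenPosMeasure`). This DEFINITION file provides the
measured-flow versions, taking the flows and the measure families explicitly, without touching
`MetricFlowFDistance.lean`:

* `MetricFlow.kernelDistWithin'`, `MetricFlow.FDistAdmissibleWith'`, `MetricFlow.FDistAdmissible'`,
  `MetricFlow.fDistWithin'` — Def. 5.6 for `(𝒳¹, μ¹)`, `(𝒳², μ²)` within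
  `ℭ : Correspondence₂ 𝒳¹ 𝒳² I''`;
* bridges to the pair versions, all definitional: `MetricFlowPair.kernelDistWithin_eq'`,
  `MetricFlowPair.fDistAdmissible_iff'`, `MetricFlowPair.fDistAdmissibleWith_iff'`,
  `fDistWithin_eq_fDistWithin'`;
* the API of the pair versions: `FDistAdmissible'.mono`, `.anti_J`, `fDistWithin'_le`,
  `le_fDistWithin'_iff`, `fDistWithin'_mono`, symmetry (`FDistAdmissible'.swap`,
  `fDistWithin'_swap`), restriction to a window (`FDistAdmissible'.restrict`,
  `fDistWithin'_restrict_le`), and Remark 5.7 (`FDistAdmissibleWith'.wassersteinW1_map_le`: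
  `d^{Z_t}_{W₁}((φ¹_t)_* μ¹_t, (φ²_t)_* μ²_t) ≤ r` off the exceptional set).

## References

* R. H. Bamler, *Compactness theory of the space of super Ricci flows*, Invent. Math. 233 (2023),
  1121–1277 (arXiv:2008.09298), §5.1 Def. 5.6, Rem. 5.7; §6.4 Lemma 6.10, Lemma 6.12; §6.5
  Thm. 6.13. [Bamler2023]
-/

noncomputable section

open Set MeasureTheory Filter TopologicalSpace Function
open scoped Topology ENNReal NNReal

namespace Literature.Geometry.Riemannian

universe u

namespace MetricFlow

variable {I₁ I₂ : Set ℝ}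

/-! ### Def. 5.6 for measured flows -/

/-- The integrand of condition (2) of Def. 5.6 for two metric flows in a correspondence:
`d_{W₁}^{Z_s}((φ¹_s)_* ν¹_{x¹;s}, (φ²_s)_* ν²_{x²;s})` for `s ≤ t` at which both embeddings are
defined (the same expression as `MetricFlowPair.kernelDistWithin`, which never used the measures).
[cite: Bamler2023, §5.1, Def. 5.6 (F-distance within correspondence)] -/
def kernelDistWithin' (𝒳₁ : MetricFlow.{u} I₁) (𝒳₂ : MetricFlow.{u} I₂) {I'' : Set ℝ}
    (ℭ : Correspondence₂ 𝒳₁ 𝒳₂ I'') {s t : ℝ} (hs₁ : s ∈ ℭ.dom₁) (hs₂ : s ∈ ℭ.dom₂)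
    (ht₁ : t ∈ ℭ.dom₁) (ht₂ : t ∈ ℭ.dom₂)
    (p : 𝒳₁.Slice ⟨t, (ℭ.dom₁_subset ht₁).1⟩ × 𝒳₂.Slice ⟨t, (ℭ.dom₂_subset ht₂).1⟩) : ℝ≥0∞ :=
  wassersteinW1 (X := ℭ.Z ⟨s, (ℭ.dom₁_subset hs₁).2⟩)
    ((𝒳₁.condKernel p.1 ⟨s, (ℭ.dom₁_subset hs₁).1⟩).map (ℭ.φ₁ s hs₁))
    ((𝒳₂.condKernel p.2 ⟨s, (ℭ.dom₂_subset hs₂).1⟩).map (ℭ.φ₂ s hs₂))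

/-- **Admissible radii with a given exceptional set `E` for measured flows** (the property of
Def. 5.6 with `E` fixed, for measure families `μ¹, μ²`): `r > 0`, `E ⊆ I''` measurable,
`J ⊆ I'' ∖ E ⊆ I''^{,1} ∩ I''^{,2}`, `|E| ≤ r²`, couplings `q_t` of `μ¹_t, μ²_t` (`t ∈ I'' ∖ E`),
and `∫ d_{W₁}^{Z_s}((φ¹_s)_* ν¹_{x¹;s}, (φ²_s)_* ν²_{x²;s}) dq_t ≤ r` for `s ≤ t` in `I'' ∖ E`.
[cite: Bamler2023, §5.1, Def. 5.6 (F-distance within correspondence)] -/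
def FDistAdmissibleWith' (𝒳₁ : MetricFlow.{u} I₁) (𝒳₂ : MetricFlow.{u} I₂)
    (μ₁ : ∀ t : I₁, Measure (𝒳₁.Slice t)) (μ₂ : ∀ t : I₂, Measure (𝒳₂.Slice t)) {I'' : Set ℝ}
    (ℭ : Correspondence₂ 𝒳₁ 𝒳₂ I'') (E J : Set ℝ) (r : ℝ) : Prop :=
  0 < r ∧ ∃ (_ : MeasurableSet E) (_ : E ⊆ I'') (_ : J ⊆ I'' \ E)
    (hE₁ : I'' \ E ⊆ ℭ.dom₁) (hE₂ : I'' \ E ⊆ ℭ.dom₂) (_ : volume E ≤ ENNReal.ofReal (r ^ 2))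
    (q : ∀ t (ht : t ∈ I'' \ E),
      Measure (𝒳₁.Slice ⟨t, (ℭ.dom₁_subset (hE₁ ht)).1⟩ ×
        𝒳₂.Slice ⟨t, (ℭ.dom₂_subset (hE₂ ht)).1⟩)),
    (∀ t (ht : t ∈ I'' \ E),
      IsCoupling (μ₁ ⟨t, (ℭ.dom₁_subset (hE₁ ht)).1⟩) (μ₂ ⟨t, (ℭ.dom₂_subset (hE₂ ht)).1⟩)
        (q t ht)) ∧
    ∀ s (hs : s ∈ I'' \ E) t (ht : t ∈ I'' \ E), s ≤ t →
      ∫⁻ p, kernelDistWithin' 𝒳₁ 𝒳₂ ℭ (hE₁ hs) (hE₂ hs) (hE₁ ht) (hE₂ ht) p ∂(q t ht) ≤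
        ENNReal.ofReal r

/-- **Admissible radii for `d_𝔽^{ℭ,J}` between measured flows** (Def. 5.6 with arbitrary conjugate
heat flows, as in §6.4–6.5).
[cite: Bamler2023, §5.1, Def. 5.6 (F-distance within correspondence)] -/
def FDistAdmissible' (𝒳₁ : MetricFlow.{u} I₁) (𝒳₂ : MetricFlow.{u} I₂)
    (μ₁ : ∀ t : I₁, Measure (𝒳₁.Slice t)) (μ₂ : ∀ t : I₂, Measure (𝒳₂.Slice t)) {I'' : Set ℝ}
    (ℭ : Correspondence₂ 𝒳₁ 𝒳₂ I'') (J : Set ℝ) (r : ℝ) : Prop :=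
  0 < r ∧ ∃ (E : Set ℝ) (_ : MeasurableSet E) (_ : E ⊆ I'') (_ : J ⊆ I'' \ E)
    (hE₁ : I'' \ E ⊆ ℭ.dom₁) (hE₂ : I'' \ E ⊆ ℭ.dom₂) (_ : volume E ≤ ENNReal.ofReal (r ^ 2))
    (q : ∀ t (ht : t ∈ I'' \ E),
      Measure (𝒳₁.Slice ⟨t, (ℭ.dom₁_subset (hE₁ ht)).1⟩ ×
        𝒳₂.Slice ⟨t, (ℭ.dom₂_subset (hE₂ ht)).1⟩)),
    (∀ t (ht : t ∈ I'' \ E),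
      IsCoupling (μ₁ ⟨t, (ℭ.dom₁_subset (hE₁ ht)).1⟩) (μ₂ ⟨t, (ℭ.dom₂_subset (hE₂ ht)).1⟩)
        (q t ht)) ∧
    ∀ s (hs : s ∈ I'' \ E) t (ht : t ∈ I'' \ E), s ≤ t →
      ∫⁻ p, kernelDistWithin' 𝒳₁ 𝒳₂ ℭ (hE₁ hs) (hE₂ hs) (hE₁ ht) (hE₂ ht) p ∂(q t ht) ≤
        ENNReal.ofReal r

/-- **The `𝔽`-distance within `ℭ`, uniform over `J`, between two measured flows**
`d_𝔽^{ℭ,J}((𝒳¹, (μ¹_t)), (𝒳², (μ²_t))) = inf {r > 0 admissible}` (valued in `[0, ∞]`).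
[cite: Bamler2023, §5.1, Def. 5.6 (F-distance within correspondence)] -/
def fDistWithin' (𝒳₁ : MetricFlow.{u} I₁) (𝒳₂ : MetricFlow.{u} I₂)
    (μ₁ : ∀ t : I₁, Measure (𝒳₁.Slice t)) (μ₂ : ∀ t : I₂, Measure (𝒳₂.Slice t)) {I'' : Set ℝ}
    (ℭ : Correspondence₂ 𝒳₁ 𝒳₂ I'') (J : Set ℝ) : ℝ≥0∞ :=
  ⨅ (r : ℝ) (_ : FDistAdmissible' 𝒳₁ 𝒳₂ μ₁ μ₂ ℭ J r), ENNReal.ofReal r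

variable {𝒳₁ : MetricFlow.{u} I₁} {𝒳₂ : MetricFlow.{u} I₂} {μ₁ : ∀ t : I₁, Measure (𝒳₁.Slice t)}
  {μ₂ : ∀ t : I₂, Measure (𝒳₂.Slice t)} {I'' : Set ℝ} {ℭ : Correspondence₂ 𝒳₁ 𝒳₂ I''}
  {J E : Set ℝ} {r : ℝ}

/-! ### Basic API -/

/-- `r` is admissible iff it is admissible with some exceptional set.
[cite: Bamler2023, §5.1, Def. 5.6 (F-distance within correspondence)] -/
theorem fDistAdmissible'_iff_exists :
    FDistAdmissible' 𝒳₁ 𝒳₂ μ₁ μ₂ ℭ J r ↔ ∃ E, FDistAdmissibleWith' 𝒳₁ 𝒳₂ μ₁ μ₂ ℭ E J r :=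
  ⟨fun ⟨hr, E, h⟩ ↦ ⟨E, hr, h⟩, fun ⟨E, hr, h⟩ ↦ ⟨hr, E, h⟩⟩

/-- Admissibility with `E` implies admissibility.
[cite: Bamler2023, §5.1, Def. 5.6 (F-distance within correspondence)] -/
theorem FDistAdmissibleWith'.fDistAdmissible' (h : FDistAdmissibleWith' 𝒳₁ 𝒳₂ μ₁ μ₂ ℭ E J r) :
    FDistAdmissible' 𝒳₁ 𝒳₂ μ₁ μ₂ ℭ J r :=
  fDistAdmissible'_iff_exists.2 ⟨E, h⟩

/-- Admissibility is an up-set in `r` (same witnesses).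
[cite: Bamler2023, §5.1, Def. 5.6 (F-distance within correspondence)] -/
theorem FDistAdmissible'.mono {r' : ℝ} (h : FDistAdmissible' 𝒳₁ 𝒳₂ μ₁ μ₂ ℭ J r) (hrr' : r ≤ r') :
    FDistAdmissible' 𝒳₁ 𝒳₂ μ₁ μ₂ ℭ J r' := by
  obtain ⟨hr, E, hEm, hEI, hJ, hE₁, hE₂, hvol, q, hq, hint⟩ := h
  refine ⟨hr.trans_le hrr', E, hEm, hEI, hJ, hE₁, hE₂, hvol.trans ?_, q, hq, fun s hs t ht hst ↦
    (hint s hs t ht hst).trans (ENNReal.ofReal_le_ofReal hrr')⟩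
  exact ENNReal.ofReal_le_ofReal (pow_le_pow_left₀ hr.le hrr' 2)

/-- Shrinking `J` keeps radii admissible.
[cite: Bamler2023, §5.1, Def. 5.6 (F-distance within correspondence)] -/
theorem FDistAdmissible'.anti_J {J' : Set ℝ} (h : FDistAdmissible' 𝒳₁ 𝒳₂ μ₁ μ₂ ℭ J r)
    (hJ : J' ⊆ J) : FDistAdmissible' 𝒳₁ 𝒳₂ μ₁ μ₂ ℭ J' r := by
  obtain ⟨hr, E, hEm, hEI, hJE, hE₁, hE₂, hvol, q, hq, hint⟩ := h
  exact ⟨hr, E, hEm, hEI, hJ.trans hJE, hE₁, hE₂, hvol, q, hq, hint⟩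

/-- The same witnesses are admissible for `J ∪ {t}` whenever `t ∈ I'' ∖ E` (Lemma 6.3).
[cite: Bamler2023, §6.1, Lemma 6.3] -/
theorem FDistAdmissibleWith'.insert_time (h : FDistAdmissibleWith' 𝒳₁ 𝒳₂ μ₁ μ₂ ℭ E J r) {t : ℝ}
    (ht : t ∈ I'') (htE : t ∉ E) : FDistAdmissibleWith' 𝒳₁ 𝒳₂ μ₁ μ₂ ℭ E (insert t J) r := by
  obtain ⟨hr, hEm, hEI, hJ, hE₁, hE₂, hvol, q, hq, hint⟩ := h
  exact ⟨hr, hEm, hEI, insert_subset_iff.2 ⟨⟨ht, htE⟩, hJ⟩, hE₁, hE₂, hvol, q, hq, hint⟩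

/-- Every admissible radius bounds `d_𝔽^{ℭ,J}`.
[cite: Bamler2023, §5.1, Def. 5.6 (F-distance within correspondence)] -/
theorem fDistWithin'_le (h : FDistAdmissible' 𝒳₁ 𝒳₂ μ₁ μ₂ ℭ J r) :
    fDistWithin' 𝒳₁ 𝒳₂ μ₁ μ₂ ℭ J ≤ ENNReal.ofReal r :=
  iInf₂_le r h

/-- `a ≤ d_𝔽^{ℭ,J}` iff `a ≤ r` for every admissible `r`.
[cite: Bamler2023, §5.1, Def. 5.6 (F-distance within correspondence)] -/
theorem le_fDistWithin'_iff {a : ℝ≥0∞} :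
    a ≤ fDistWithin' 𝒳₁ 𝒳₂ μ₁ μ₂ ℭ J ↔
      ∀ r : ℝ, FDistAdmissible' 𝒳₁ 𝒳₂ μ₁ μ₂ ℭ J r → a ≤ ENNReal.ofReal r := by
  simp only [fDistWithin', le_iInf_iff]

/-- `d_𝔽^{ℭ,J'} ≤ d_𝔽^{ℭ,J}` for `J' ⊆ J`.
[cite: Bamler2023, §5.1, Def. 5.6 (F-distance within correspondence)] -/
theorem fDistWithin'_mono {J' : Set ℝ} (hJ : J' ⊆ J) :
    fDistWithin' 𝒳₁ 𝒳₂ μ₁ μ₂ ℭ J' ≤ fDistWithin' 𝒳₁ 𝒳₂ μ₁ μ₂ ℭ J :=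
  le_fDistWithin'_iff.2 fun _ hr ↦ fDistWithin'_le (hr.anti_J hJ)

/-- A `𝔽`-distance below `ofReal c` makes `c` admissible, with some exceptional set.
[cite: Bamler2023, §5.1, Def. 5.6 (F-distance within correspondence)] -/
theorem exists_fDistAdmissibleWith'_of_fDistWithin'_lt {c : ℝ} (hc : 0 < c)
    (h : fDistWithin' 𝒳₁ 𝒳₂ μ₁ μ₂ ℭ J < ENNReal.ofReal c) :
    ∃ E, FDistAdmissibleWith' 𝒳₁ 𝒳₂ μ₁ μ₂ ℭ E J c := by
  simp only [fDistWithin', iInf_lt_iff] at h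
  obtain ⟨r, hr, hrc⟩ := h
  exact fDistAdmissible'_iff_exists.1 (hr.mono ((ENNReal.ofReal_lt_ofReal_iff hc).1 hrc).le)

/-! ### Symmetry -/

/-- The integrand is symmetric under swapping the correspondence and the pair of points.
[cite: Bamler2023, §5.1, Def. 5.6 (F-distance within correspondence)] -/
theorem kernelDistWithin'_swap (ℭ : Correspondence₂ 𝒳₁ 𝒳₂ I'') {s t : ℝ} (hs₁ : s ∈ ℭ.dom₁)
    (hs₂ : s ∈ ℭ.dom₂) (ht₁ : t ∈ ℭ.dom₁) (ht₂ : t ∈ ℭ.dom₂)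
    (p : 𝒳₁.Slice ⟨t, (ℭ.dom₁_subset ht₁).1⟩ × 𝒳₂.Slice ⟨t, (ℭ.dom₂_subset ht₂).1⟩) :
    kernelDistWithin' 𝒳₂ 𝒳₁ ℭ.swap hs₂ hs₁ ht₂ ht₁ p.swap =
      kernelDistWithin' 𝒳₁ 𝒳₂ ℭ hs₁ hs₂ ht₁ ht₂ p :=
  wassersteinW1_comm _ _

/-- **Admissible radii are symmetric** (same `E`, couplings pushed forward by `Prod.swap`).
[cite: Bamler2023, §5.1, Def. 5.6 (F-distance within correspondence)] -/
theorem FDistAdmissible'.swap (h : FDistAdmissible' 𝒳₁ 𝒳₂ μ₁ μ₂ ℭ J r) :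
    FDistAdmissible' 𝒳₂ 𝒳₁ μ₂ μ₁ ℭ.swap J r := by
  obtain ⟨hr, E, hEm, hEI, hJ, hE₁, hE₂, hvol, q, hq, hint⟩ := h
  refine ⟨hr, E, hEm, hEI, hJ, hE₂, hE₁, hvol, fun t ht ↦ (q t ht).map Prod.swap, fun t ht ↦ ?_,
    fun s hs t ht hst ↦ ?_⟩
  · obtain ⟨hP, h1, h2⟩ := hq t ht
    haveI := hP
    exact ⟨Measure.isProbabilityMeasure_map measurable_swap.aemeasurable,
      by rw [Measure.fst_map_swap]; exact h2, by rw [Measure.snd_map_swap]; exact h1⟩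
  · refine le_trans (le_of_eq ?_) (hint s hs t ht hst)
    change ∫⁻ p, kernelDistWithin' 𝒳₂ 𝒳₁ ℭ.swap (hE₂ hs) (hE₁ hs) (hE₂ ht) (hE₁ ht) p
      ∂((q t ht).map Prod.swap) = _
    rw [show (Prod.swap : 𝒳₁.Slice ⟨t, (ℭ.dom₁_subset (hE₁ ht)).1⟩ ×
          𝒳₂.Slice ⟨t, (ℭ.dom₂_subset (hE₂ ht)).1⟩ → _) =
        ⇑(MeasurableEquiv.prodComm : _ ≃ᵐ _) from rfl, lintegral_map_equiv]
    refine lintegral_congr fun p ↦ ?_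
    simp only [MeasurableEquiv.prodComm, MeasurableEquiv.coe_mk, Equiv.prodComm_apply]
    exact kernelDistWithin'_swap ℭ (hE₁ hs) (hE₂ hs) (hE₁ ht) (hE₂ ht) p

/-- **`d_𝔽^{ℭ.swap,J}((𝒳², μ²), (𝒳¹, μ¹)) = d_𝔽^{ℭ,J}((𝒳¹, μ¹), (𝒳², μ²))`.**
[cite: Bamler2023, §5.1, Def. 5.6 (F-distance within correspondence)] -/
theorem fDistWithin'_swap (ℭ : Correspondence₂ 𝒳₁ 𝒳₂ I'') (J : Set ℝ) :
    fDistWithin' 𝒳₂ 𝒳₁ μ₂ μ₁ ℭ.swap J = fDistWithin' 𝒳₁ 𝒳₂ μ₁ μ₂ ℭ J := by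
  refine le_antisymm ?_ ?_
  · exact le_fDistWithin'_iff.2 fun r hr ↦ fDistWithin'_le hr.swap
  · refine le_fDistWithin'_iff.2 fun r hr ↦ fDistWithin'_le ?_
    have := hr.swap
    rwa [Correspondence₂.swap_swap] at this

/-! ### Restriction to a window -/

/-- **Restriction keeps radii admissible**: for measurable `I₀ ⊆ I''`, an admissible `r` for
`d_𝔽^{ℭ,J}` is admissible for the restricted flows (to any `Iᵢ' ⊆ Iᵢ` containing `domᵢ ∩ I₀`),
with the restricted measures, within `ℭ|_{I₀}`, uniformly over `J ∩ I₀` (exceptional set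
`E ∩ I₀`, the same couplings). [cite: Bamler2023, §6.1, Def. 6.1; §5.1, Def. 5.6] -/
theorem FDistAdmissible'.restrict (h : FDistAdmissible' 𝒳₁ 𝒳₂ μ₁ μ₂ ℭ J r) {I₀ I₁' I₂' : Set ℝ}
    (hI₀ : MeasurableSet I₀) (h₀ : I₀ ⊆ I'') (h₁ : I₁' ⊆ I₁) (h₂ : I₂' ⊆ I₂)
    (hd₁ : ℭ.dom₁ ∩ I₀ ⊆ I₁') (hd₂ : ℭ.dom₂ ∩ I₀ ⊆ I₂') :
    FDistAdmissible' (𝒳₁.restrict h₁) (𝒳₂.restrict h₂) (fun t ↦ μ₁ ⟨t, h₁ t.2⟩)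
      (fun t ↦ μ₂ ⟨t, h₂ t.2⟩) (ℭ.restrict h₀ h₁ h₂ hd₁ hd₂) (J ∩ I₀) r := by
  obtain ⟨hr, E, hEm, hEI, hJE, hE₁, hE₂, hvol, q, hq, hint⟩ := h
  have hsub : ∀ {t : ℝ}, t ∈ I₀ \ (E ∩ I₀) → t ∈ I'' \ E :=
    fun {t} ht ↦ ⟨h₀ ht.1, fun hE ↦ ht.2 ⟨hE, ht.1⟩⟩
  refine ⟨hr, E ∩ I₀, hEm.inter hI₀, inter_subset_right, ?_, ?_, ?_, ?_, ?_, ?_, ?_⟩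
  · exact fun t ht ↦ ⟨ht.2, fun hE ↦ (hJE ht.1).2 hE.1⟩
  · exact fun t ht ↦ ⟨hE₁ (hsub ht), ht.1⟩
  · exact fun t ht ↦ ⟨hE₂ (hsub ht), ht.1⟩
  · exact (measure_mono inter_subset_left).trans hvol
  · exact fun t ht ↦ q t (hsub ht)
  · exact fun t ht ↦ hq t (hsub ht)
  · intro s hs t ht hst
    exact hint s (hsub hs) t (hsub ht) hst

/-- **`d_𝔽` within the restricted correspondence is at most `d_𝔽^{ℭ,J}`.**
[cite: Bamler2023, §6.1, Def. 6.1] -/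
theorem fDistWithin'_restrict_le {I₀ I₁' I₂' : Set ℝ} (hI₀ : MeasurableSet I₀) (h₀ : I₀ ⊆ I'')
    (h₁ : I₁' ⊆ I₁) (h₂ : I₂' ⊆ I₂) (hd₁ : ℭ.dom₁ ∩ I₀ ⊆ I₁') (hd₂ : ℭ.dom₂ ∩ I₀ ⊆ I₂') :
    fDistWithin' (𝒳₁.restrict h₁) (𝒳₂.restrict h₂) (fun t ↦ μ₁ ⟨t, h₁ t.2⟩)
      (fun t ↦ μ₂ ⟨t, h₂ t.2⟩) (ℭ.restrict h₀ h₁ h₂ hd₁ hd₂) (J ∩ I₀) ≤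
      fDistWithin' 𝒳₁ 𝒳₂ μ₁ μ₂ ℭ J :=
  le_fDistWithin'_iff.2 fun _ hr ↦ fDistWithin'_le (hr.restrict hI₀ h₀ h₁ h₂ hd₁ hd₂)

/-! ### Remark 5.7: the push-forwards of the measures are `r`-close off the exceptional set -/

/-- **Remark 5.7** for measured flows: an admissible `r` with exceptional set `E` gives
`d^{Z_t}_{W₁}((φ¹_t)_* μ¹_t, (φ²_t)_* μ²_t) ≤ r` for every `t ∈ I'' ∖ E` (push the coupling `q_t`
forward by `φ¹_t × φ²_t`; at `s = t` the integrand is `≥ d^{Z_t}(φ¹_t x¹, φ²_t x²)` since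
`ν_{x;t} = δ_x`). [cite: Bamler2023, §5.1, Rem. 5.7] -/
theorem FDistAdmissibleWith'.wassersteinW1_map_le (h : FDistAdmissibleWith' 𝒳₁ 𝒳₂ μ₁ μ₂ ℭ E J r)
    {t : ℝ} (ht : t ∈ I'' \ E) (h₁ : t ∈ ℭ.dom₁) (h₂ : t ∈ ℭ.dom₂) :
    wassersteinW1 (X := ℭ.Z ⟨t, (ℭ.dom₁_subset h₁).2⟩)
      ((μ₁ ⟨t, (ℭ.dom₁_subset h₁).1⟩).map (ℭ.φ₁ t h₁))
      ((μ₂ ⟨t, (ℭ.dom₂_subset h₂).1⟩).map (ℭ.φ₂ t h₂)) ≤ ENNReal.ofReal r := by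
  obtain ⟨_, _, _, _, hE₁, hE₂, _, q, hq, hint⟩ := h
  have hm₁ : Measurable (ℭ.φ₁ t h₁) := (ℭ.isometry₁ t h₁).continuous.measurable
  have hm₂ : Measurable (ℭ.φ₂ t h₂) := (ℭ.isometry₂ t h₂).continuous.measurable
  have hc := (hq t ht).map_prodMap hm₁ hm₂
  refine ((wassersteinW1_le_lintegral hc).trans (lintegral_map_le _ _)).trans ?_
  refine le_trans (lintegral_mono fun p ↦ ?_) (hint t ht t ht le_rfl)
  show edist (Prod.map (ℭ.φ₁ t h₁) (ℭ.φ₂ t h₂) p).1 (Prod.map (ℭ.φ₁ t h₁) (ℭ.φ₂ t h₂) p).2 ≤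
    kernelDistWithin' 𝒳₁ 𝒳₂ ℭ (hE₁ ht) (hE₂ ht) (hE₁ ht) (hE₂ ht) p
  rw [Prod.map_fst, Prod.map_snd]
  unfold kernelDistWithin'
  rw [𝒳₁.condKernel_self, 𝒳₂.condKernel_self, Measure.map_dirac' hm₁, Measure.map_dirac' hm₂]
  exact edist_le_wassersteinW1_dirac _ _

end MetricFlow

/-! ### Bridges to the metric flow pair versions -/

namespace MetricFlowPair

open MetricFlow

variable {I₁ I₂ : Set ℝ} (P₁ : MetricFlowPair.{u} I₁) (P₂ : MetricFlowPair.{u} I₂) {I'' : Set ℝ}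

/-- The integrand of Def. 5.6 for pairs is the measured-flow integrand of their flows.
[cite: Bamler2023, §5.1, Def. 5.6 (F-distance within correspondence)] -/
theorem kernelDistWithin_eq' (ℭ : Correspondence₂ P₁.flow P₂.flow I'') {s t : ℝ}
    (hs₁ : s ∈ ℭ.dom₁) (hs₂ : s ∈ ℭ.dom₂) (ht₁ : t ∈ ℭ.dom₁) (ht₂ : t ∈ ℭ.dom₂)
    (p : P₁.flow.Slice ⟨t, (ℭ.dom₁_subset ht₁).1⟩ × P₂.flow.Slice ⟨t, (ℭ.dom₂_subset ht₂).1⟩) :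
    kernelDistWithin P₁ P₂ ℭ hs₁ hs₂ ht₁ ht₂ p =
      kernelDistWithin' P₁.flow P₂.flow ℭ hs₁ hs₂ ht₁ ht₂ p := rfl

/-- Admissibility for pairs is admissibility for their flows and measures.
[cite: Bamler2023, §5.1, Def. 5.6 (F-distance within correspondence)] -/
theorem fDistAdmissible_iff' (ℭ : Correspondence₂ P₁.flow P₂.flow I'') (J : Set ℝ) (r : ℝ) :
    FDistAdmissible P₁ P₂ ℭ J r ↔ FDistAdmissible' P₁.flow P₂.flow P₁.μ P₂.μ ℭ J r := Iff.rfl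

/-- Admissibility with `E` for pairs is admissibility with `E` for their flows and measures.
[cite: Bamler2023, §5.1, Def. 5.6 (F-distance within correspondence)] -/
theorem fDistAdmissibleWith_iff' (ℭ : Correspondence₂ P₁.flow P₂.flow I'') (E J : Set ℝ) (r : ℝ) :
    FDistAdmissibleWith P₁ P₂ ℭ E J r ↔
      FDistAdmissibleWith' P₁.flow P₂.flow P₁.μ P₂.μ ℭ E J r := Iff.rfl

end MetricFlowPair

/-- **The `𝔽`-distance within a correspondence between two metric flow pairs is the measured-flow
`𝔽`-distance between their flows carrying their measures** (definitional).
[cite: Bamler2023, §5.1, Def. 5.6 (F-distance within correspondence)] -/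
theorem fDistWithin_eq_fDistWithin' {I₁ I₂ I'' : Set ℝ} (P₁ : MetricFlowPair.{u} I₁)
    (P₂ : MetricFlowPair.{u} I₂) (ℭ : MetricFlow.Correspondence₂ P₁.flow P₂.flow I'') (J : Set ℝ) :
    MetricFlowPair.fDistWithin P₁ P₂ ℭ J =
      MetricFlow.fDistWithin' P₁.flow P₂.flow P₁.μ P₂.μ ℭ J := rfl

end Literature.Geometry.Riemannian

end
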